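import Summits.ABC.StewartYu.PadicTwistPack
import Summits.ABC.StewartYu.PadicTwistCoreBound
import Summits.ABC.StewartYu.PadicTwistEngine
import Summits.ABC.StewartYu.PadicW80ParLEnvelope
import HarnessLib

/-!
# Cell abc-stewartyu, WP-Y3 (xiii): packs exist, the core bound, THE ENGINE at `p ≡ 3 (mod 4)`

`Summits/ABC/StewartYu/PadicTwistFinal.lean` — cell `abc-stewartyu` (seat p2; crux stmt-ABC-19485
`W80ThreeModFour`; theorems only, no named fact): `twistCoreBound_of_packs` (packs for `d ≥ 1` +
the `d = 0` Liouville case `PadicTwistCoreBound`), `packs_exist` (the record is the data with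
`ℓ = log p`, `Mcl = G`; p1's envelope `U_le_Cw'`), `twistCoreBound_holds` (`C m = 2·Cw m`), and
**`engineThreeModFourW80`** — verbatim the hypothesis `hE` of p3's
`YuNinetyW80.threeModFour_of_w80Engine`.

## References
* [Yu1990] K. Yu, Compositio Math. 74 (1990), Theorem 2.1.
* [Waldschmidt1980] M. Waldschmidt, Acta Arith. 37 (1980), Prop. 3.8.
-/

noncomputable section

open Finset Height
open Literature.NumberTheory.Transcendental

namespace Summit.ABC.StewartYu

namespace TwistSetup

variable {p : ℕ} [Fact p.Prime]

/-! ### Packs exist; the core bound; the engine -/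

/-- **Packs for every twisted set-up with `d ≥ 1` give the core bound** (the case `d = 0` by
Liouville, for `3 ≤ C 1`). [cite: Yu1990, Proposition 2.1] [cite: Waldschmidt1980, Prop. 3.8] -/
theorem twistCoreBound_of_packs {C : ℕ → ℝ} (hC1 : 3 ≤ C 1)
    (hpk : ∀ (p : ℕ) [Fact p.Prime] (S : TwistSetup p) (V : Fin S.d → ℝ) (Vθ Vmax W : ℝ), 1 ≤ S.d →
      Odd S.G → S.G ≤ p → (∀ T : Finset (Fin (S.d + 1)), T.Nonempty → ¬ IsSquare (∏ i ∈ T, S.toQ.all i)) →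
      (∀ μ : Fin (S.d + 1) → ℤ, ∏ i, S.toQ.all i ^ μ i = 1 → μ = 0) →
      (∀ j, logHeight₁ (S.α j) ≤ V j) → logHeight₁ S.θ ≤ Vθ →
      (∀ j, Real.log p ≤ V j) → Real.log p ≤ Vθ → (∀ j, V j ≤ Vmax) → Vθ ≤ Vmax →
      (∀ j, Real.log (max 3 (|S.b j| : ℝ)) ≤ W) → Real.log (max 3 (|S.bθ| : ℝ)) ≤ W → Real.log p ≤ W →
      Nonempty (S.ParamPack (C (S.d + 1) * S.G * ((∏ j, V j / Real.log p) * (Vθ / Real.log p)) *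
        (W + Real.log (2 * Vmax)) * Real.log (2 * Vmax)))) :
    TwistCoreBound C := by
  intro p _ S V Vθ Vmax W hodd hGp hK hμ hV hVθ hVp hVθp hVm hVθm hW hWθ hWp
  rcases Nat.eq_zero_or_pos S.d with hd | hd
  · have hKθ : ¬ IsSquare S.θ := by
      have := hK {Fin.last S.d} ⟨_, Finset.mem_singleton_self _⟩
      rw [Finset.prod_singleton] at this
      unfold SetupQ.all at this; rwa [Fin.snoc_last] at this
    exact S.coreBound_of_d_zero hd hodd hC1 hKθ V Vθ Vmax W hVθ hVθp hVθm hWp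
  · obtain ⟨pk⟩ := hpk p S V Vθ Vmax W hd hodd hGp hK hμ hV hVθ hVp hVθp hVm hVθm hW hWθ hWp
    exact not_le.mp (S.not_norm_Λ₀_le_of_paramPack pk)


/-- `2·Cw m ≤ (2⁷⁰)^m · m^m` for `m ≥ 1`. [folklore] -/
theorem two_mul_Cw_le_pow {m : ℕ} (hm : 1 ≤ m) :
    2 * PadicW80Par.Cw m ≤ (2 ^ 70 : ℝ) ^ m * (m : ℝ) ^ m := by
  unfold PadicW80Par.Cw
  have h0 : (0 : ℝ) ≤ (2 ^ 69 * m : ℝ) ^ m := by positivity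
  have h2 : (2 : ℝ) ≤ 2 ^ m := by
    calc (2 : ℝ) = 2 ^ 1 := (pow_one _).symm
      _ ≤ 2 ^ m := pow_le_pow_right₀ (by norm_num) hm
  calc 2 * ((2 : ℝ) ^ 69 * m) ^ m ≤ 2 ^ m * ((2 : ℝ) ^ 69 * m) ^ m := mul_le_mul_of_nonneg_right h2 h0
    _ = (2 ^ 70 : ℝ) ^ m * (m : ℝ) ^ m := by rw [← mul_pow, ← mul_pow]; ring

/-- **Packs exist** for every twisted set-up with `d ≥ 1`, odd `G ≤ p`, Kummer-free signed
generators, heights `≤ V`, floors `log p ≤ V ≤ Vmax`, `log p ≤ W`: the record is the data itself with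
`ℓ = log p`, `Mcl = G`; exponent `P.Uℓ ≤ 2·Cw(d+1)·G·∏(Vⱼ/log p)(V_θ/log p)·(W + log 2Vmax)·log 2Vmax`.
[folklore] -/
theorem packs_exist (S : TwistSetup p) (V : Fin S.d → ℝ) (Vθ Vmax W : ℝ) (hd : 1 ≤ S.d)
    (hodd : Odd S.G) (hGp : S.G ≤ p)
    (hK : ∀ T : Finset (Fin (S.d + 1)), T.Nonempty → ¬ IsSquare (∏ i ∈ T, S.toQ.all i))
    (hV : ∀ j, Height.logHeight₁ (S.α j) ≤ V j) (hVθ : Height.logHeight₁ S.θ ≤ Vθ)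
    (hVp : ∀ j, Real.log p ≤ V j) (hVθp : Real.log p ≤ Vθ) (hVm : ∀ j, V j ≤ Vmax) (hVθm : Vθ ≤ Vmax)
    (hW : ∀ j, Real.log (max 3 (|S.b j| : ℝ)) ≤ W) (hWθ : Real.log (max 3 (|S.bθ| : ℝ)) ≤ W)
    (hWp : Real.log p ≤ W) :
    Nonempty (S.ParamPack ((2 * PadicW80Par.Cw (S.d + 1)) * S.G *
      ((∏ j, V j / Real.log p) * (Vθ / Real.log p)) * (W + Real.log (2 * Vmax)) * Real.log (2 * Vmax))) := by
  have hlog3 : (1 : ℝ) < Real.log 3 := by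
    rw [Real.lt_log_iff_exp_lt (by norm_num)]
    have := Real.exp_one_lt_d9; norm_num at this; linarith
  have hlp : (1 : ℝ) ≤ Real.log p := hlog3.le.trans (Real.log_le_log (by norm_num) S.three_le_p)
  have hG1 : (1 : ℝ) ≤ S.G := by exact_mod_cast S.hG
  have hGlog : Real.log S.G ≤ Real.log p :=
    Real.log_le_log (by exact_mod_cast S.hG) (by exact_mod_cast hGp)
  let P : PadicW80ParL S.d :=
    { V := V, Vm := Vmax, Vθ := Vθ, W := W, ℓ := Real.log p, Mcl := S.G
      hℓ := hlp, hVℓ := hVp, hVmax := hVm, hVθℓ := hVθp, hVθmax := hVθm, hWℓ := hWp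
      hMcl := hG1, hMclℓ := hGlog, hd := hd }
  have pk := paramPackOf (P := P) (S.sizeHyp_of_logHeight hV hW hVθ hWθ) hK rfl rfl hodd
  have hU : P.Uℓ ≤ (2 * PadicW80Par.Cw (S.d + 1)) * S.G *
      ((∏ j, V j / Real.log p) * (Vθ / Real.log p)) * (W + Real.log (2 * Vmax)) * Real.log (2 * Vmax) := by
    have h := P.U_le_Cw'
    have e1 : (∏ j, P.nV j) * P.nVθ = (∏ j, V j / Real.log p) * (Vθ / Real.log p) := rfl
    have e2 : P.Mcl = (S.G : ℝ) := rfl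
    have e3 : P.W = W := rfl
    have e4 : P.Vm = Vmax := rfl
    rw [e1, e2, e3, e4] at h
    calc P.Uℓ ≤ _ := h
      _ = _ := by ring
  exact ⟨pk.mono hU⟩

/-- **The core bound of the twisted machine holds** with `C m = 2·Cw m = 2(2⁶⁹m)^m`. [folklore] -/
theorem twistCoreBound_holds : TwistCoreBound (fun m => 2 * PadicW80Par.Cw m) := by
  refine twistCoreBound_of_packs (by show (3 : ℝ) ≤ 2 * PadicW80Par.Cw 1; unfold PadicW80Par.Cw; norm_num) ?_
  intro p _ S V Vθ Vmax W hd hodd hGp hK _hμ hV hVθ hVp hVθp hVm hVθm hW hWθ hWp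
  exact packs_exist S V Vθ Vmax W hd hodd hGp hK hV hVθ hVp hVθp hVm hVθm hW hWθ hWp

/-- **THE ENGINE** — the Waldschmidt-shape twist engine at `p ≡ 3 (mod 4)` for arbitrary rational
`p`-adic units (`C(m) = 2·Cw(m) ≤ (2⁷⁰)^m m^m`): verbatim the hypothesis `hE` of
`YuNinetyW80.threeModFour_of_w80Engine`. [folklore] -/
theorem engineThreeModFourW80 :
    ∃ (C : ℕ → ℝ) (c₁ : ℝ), 1 ≤ c₁ ∧ (∀ m, 0 ≤ C m ∧ C m ≤ c₁ ^ m * (m : ℝ) ^ m) ∧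
      ∀ (p : ℕ), p.Prime → p % 4 = 3 → ∀ (m : ℕ) (α : Fin m → ℚ) (b : Fin m → ℤ) (V : Fin m → ℝ)
        (Vmax W : ℝ),
        (∀ j, α j ≠ 0 ∧ padicValRat p (α j) = 0) →
        (∀ μ : Fin m → ℤ, ∏ j, α j ^ μ j = 1 → μ = 0) →
        (∀ T : Finset (Fin m), T.Nonempty → ¬ IsSquare (∏ j ∈ T, α j) ∧ ¬ IsSquare (-∏ j ∈ T, α j)) →
        (∀ j, Height.logHeight₁ (α j) ≤ V j) → (∀ j, Real.log p ≤ V j) → (∀ j, V j ≤ Vmax) →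
        b ≠ 0 → (∀ j, Real.log (max 3 (|b j| : ℝ)) ≤ W) → Real.log p ≤ W →
        (padicValRat p (∏ j, α j ^ b j - 1) : ℝ) ≤
          C m * p * (∏ j, V j / Real.log p) * (W + Real.log (2 * Vmax)) * Real.log (2 * Vmax) :=
  engineW80_of_coreBound (C := fun m => 2 * PadicW80Par.Cw m) (c₁ := 2 ^ 70) (by norm_num)
    (fun m hm => by have := PadicW80Par.two_le_Cw hm; change 2 ≤ 2 * PadicW80Par.Cw m; linarith)
    (fun m hm => two_mul_Cw_le_pow hm) twistCoreBound_holds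

end TwistSetup

end Summit.ABC.StewartYu

end
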